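import Mathlib.Analysis.InnerProductSpace.LinearMap
import Mathlib.Analysis.CStarAlgebra.Matrix
import Mathlib.Analysis.Complex.Polynomial.Basic
import Mathlib.RingTheory.RootsOfUnity.Complex
import HarnessLib

/-!
# The Berger–Pearcy power inequality for the numerical radius, `w(Tⁿ) ≤ w(T)ⁿ`

Topic `Literature/Analysis/InnerProduct`; support file (all proved; no definitions; no named facts).

For a linear operator `T` on a complex inner product space `E` the numerical radius is
`w(T) = sup {|⟪x, T x⟫| : ‖x‖ = 1}`.  Mathlib (this pin) has no `numericalRadius`, so everything is
stated DEF-FREE through the hypothesis `∀ x, ‖⟪x, T x⟫‖ ≤ c ‖x‖²` (i.e. `w(T) ≤ c`), for a bare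
linear map `T : E →ₗ[ℂ] E` (no continuity, completeness or finite-dimensionality is needed):

* `numericalRadius_pow_le` : `w(Tⁿ) ≤ w(T)ⁿ` — the POWER INEQUALITY, conjectured by Halmos, first
  proved by C. A. Berger (1965, via his unitary-dilation theorem); we follow C. Pearcy's elementary
  proof (Michigan Math. J. 13 (1966) 289–291) in a polynomial-free telescoping form (no inverses,
  no dilations, no spectral theory).  Halmos, *A Hilbert space problem book*, Problem 221.
* `norm_apply_le_two_mul_of_numericalRadius_le` : `‖T‖ ≤ 2 w(T)` (polarization; Halmos, op. cit.,
  §218: `½‖A‖ ≤ w(A) ≤ ‖A‖`).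
* `matrix_norm_pow_mulVec_le_two_mul_numericalRadius_pow` : the matrix form on
  `EuclideanSpace ℂ m`: `‖Xⁿ v‖ ≤ 2 cⁿ ‖v‖` whenever `|⟪v, X v⟫| ≤ c ‖v‖²` for all `v` (column /
  vector growth of powers of a non-normal matrix is governed by its numerical radius, not its norm).

Proof of the power inequality for `c = 1`, `n ≥ 1` (`bergerPearcy_re_pow_mul_inner_pow_le`).
Fix `x` and a unit complex number `z`, let `ω = exp(2πi/n)` and `μ_j = ω^j z`.  Put
`y_j = Σ_{m<n} μ_jᵐ Tᵐ x` and `e = x - zⁿ Tⁿ x`.  Telescoping gives `y_j - μ_j T y_j = e` for every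
`j` (as `μ_jⁿ = zⁿ`), and the orthogonality relations `Σ_{j<n} ω^{jm} = n·[m = 0]` (`m < n`) give
`Σ_{j<n} y_j = n x`.  Hence `n ⟪x, e⟫ = Σ_j ⟪y_j, e⟫ = Σ_j (‖y_j‖² - μ_j ⟪y_j, T y_j⟫)` has
nonnegative real part, i.e. `Re (zⁿ ⟪x, Tⁿ x⟫) ≤ ‖x‖²` for every unit `z`; rotating `⟪x, Tⁿ x⟫`
onto the positive real axis (`ℂ` has `n`-th roots) gives `|⟪x, Tⁿ x⟫| ≤ ‖x‖²`.  The general case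
follows by scaling (`c > 0`) and from `T = 0` (`c = 0`, polarization, `inner_map_self_eq_zero`).

Deliberately NOT here: the numerical range / radius as definitions, the Toeplitz–Hausdorff theorem,
Berger's dilation theorem, and the polynomial (von Neumann–Kato–Berger–Stampfli) generalisation
`w(p(T)) ≤ 1` for `p(0) = 0`, `‖p‖_{𝔻} ≤ 1`.

## Mathlib search

Mathlib (this pin) has the polarization identities `inner_map_polarization`,
`inner_map_polarization'`, `inner_map_self_eq_zero`, primitive roots `Complex.isPrimitiveRoot_exp`,
`IsAlgClosed.exists_pow_nat_eq`, `Matrix.toEuclideanCLM`, but no numerical range / numerical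
radius and no power inequality (`lean search 'numericalRadius|numerical_radius|NumericalRange'`:
nothing).

## References

* C. Pearcy, *An elementary proof of the power inequality for the numerical radius*, Michigan
  Math. J. 13 (1966), 289–291. [Pearcy1966]
* C. A. Berger, *A strange dilation theorem*, Notices Amer. Math. Soc. 12 (1965), 590 (abstract).
* P. R. Halmos, *A Hilbert Space Problem Book*, 2nd ed., GTM 19, Springer (1982), §218 (numerical
  radius, `½‖A‖ ≤ w(A) ≤ ‖A‖`) and Problem 221 (power inequality). [HalmosHSPB1982]
-/

noncomputable section

namespace Literature.Analysis.InnerProduct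

open scoped InnerProductSpace ComplexConjugate
open _root_.Complex Finset

section PowerInequality

variable {E : Type*} [NormedAddCommGroup E] [InnerProductSpace ℂ E]

/-- `Re ⟪u, u⟫ = ‖u‖²`, with `Complex.re` (Mathlib states it with `RCLike.re`). [folklore] -/
theorem bergerPearcy_re_inner_self (u : E) : (⟪u, u⟫_ℂ).re = ‖u‖ ^ 2 :=
  inner_self_eq_norm_sq (𝕜 := ℂ) u

/-- `|⟪u, u⟫| = ‖u‖²`. [folklore] -/
theorem bergerPearcy_norm_inner_self (u : E) : ‖⟪u, u⟫_ℂ‖ = ‖u‖ ^ 2 :=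
  (inner_self_re_eq_norm (𝕜 := ℂ) u).symm.trans (inner_self_eq_norm_sq (𝕜 := ℂ) u)

/-- Orthogonality relations for roots of unity: if `ω` is a primitive `n`-th root of unity and
`0 < m < n`, then `Σ_{j<n} (ω^m)^j = 0` (geometric sum with ratio `ω^m ≠ 1`, `(ω^m)ⁿ = 1`).
[folklore] -/
theorem bergerPearcy_sum_pow_primitiveRoot_eq_zero {ω : ℂ} {n m : ℕ} (hω : IsPrimitiveRoot ω n)
    (hm0 : m ≠ 0) (hmn : m < n) : ∑ j ∈ range n, (ω ^ m) ^ j = 0 := by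
  have h1 : ω ^ m ≠ 1 := hω.pow_ne_one_of_pos_of_lt hm0 hmn
  have h2 : (∑ j ∈ range n, (ω ^ m) ^ j) * (ω ^ m - 1) = 0 := by
    rw [geom_sum_mul, pow_right_comm, hω.pow_eq_one, one_pow, sub_self]
  exact (mul_eq_zero.mp h2).resolve_right (sub_ne_zero.mpr h1)

/-- **Pearcy's lemma**, the heart of the elementary proof of Berger's power inequality
(C. Pearcy 1966).  If `|⟪y, T y⟫| ≤ ‖y‖²` for all `y`, then for every `n ≥ 1`, every unit complex
number `z` and every `x`, `Re (zⁿ ⟪x, Tⁿ x⟫) ≤ ‖x‖²`.  Polynomial-free telescoping form of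
Pearcy's argument: with `μ_j = ω^j z` (`ω` a primitive `n`-th root of unity),
`y_j = Σ_{m<n} μ_jᵐ Tᵐ x` and `e = x - zⁿ Tⁿ x` one has `y_j - μ_j T y_j = e`, `Σ_j y_j = n x`, so
`n Re ⟪x, e⟫ = Σ_j Re ⟪y_j, y_j - μ_j T y_j⟫ ≥ 0`. [cite: Pearcy1966, Theorem (proof)] -/
theorem bergerPearcy_re_pow_mul_inner_pow_le (T : E →ₗ[ℂ] E)
    (hT : ∀ x : E, ‖⟪x, T x⟫_ℂ‖ ≤ ‖x‖ ^ 2) {n : ℕ} (hn : 0 < n) {z : ℂ} (hz : ‖z‖ = 1) (x : E) :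
    (z ^ n * ⟪x, (T ^ n) x⟫_ℂ).re ≤ ‖x‖ ^ 2 := by
  obtain ⟨ω, hω⟩ : ∃ ω : ℂ, IsPrimitiveRoot ω n := ⟨_, Complex.isPrimitiveRoot_exp n hn.ne'⟩
  obtain ⟨μ, hμ⟩ : ∃ μ : ℕ → ℂ, ∀ j, μ j = ω ^ j * z := ⟨_, fun _ => rfl⟩
  obtain ⟨y, hy⟩ : ∃ y : ℕ → E, ∀ j, y j = ∑ m ∈ range n, μ j ^ m • (T ^ m) x :=
    ⟨_, fun _ => rfl⟩
  obtain ⟨e, he⟩ : ∃ e : E, e = x - z ^ n • (T ^ n) x := ⟨_, rfl⟩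
  have hμn : ∀ j, μ j ^ n = z ^ n := fun j => by
    rw [hμ, mul_pow, pow_right_comm, hω.pow_eq_one, one_pow, one_mul]
  have hμ1 : ∀ j, ‖μ j‖ = 1 := fun j => by
    rw [hμ, norm_mul, norm_pow, hω.norm'_eq_one hn.ne', one_pow, one_mul, hz]
  -- (A) telescoping: `y_j - μ_j T y_j = e`
  have hA : ∀ j, y j - μ j • T (y j) = e := fun j => by
    have h1 : μ j • T (y j) = ∑ m ∈ range n, μ j ^ (m + 1) • (T ^ (m + 1)) x := by
      simp only [hy, map_sum, map_smul, smul_sum, smul_smul, pow_succ', Module.End.mul_apply]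
    rw [h1, hy, ← sum_sub_distrib, Finset.sum_range_sub', pow_zero, pow_zero, one_smul,
      Module.End.one_apply, hμn, he]
  -- (B) orthogonality: `Σ_j y_j = n x`
  have hB : ∑ j ∈ range n, y j = (n : ℂ) • x := by
    have h1 : ∀ j m, μ j ^ m • (T ^ m) x = (ω ^ m) ^ j • (z ^ m • (T ^ m) x) := fun j m => by
      rw [smul_smul, hμ, mul_pow, ← pow_mul, ← pow_mul, mul_comm j m]
    simp only [hy, h1]
    rw [sum_comm, sum_eq_single_of_mem 0 (mem_range.mpr hn)]
    · rw [← sum_smul]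
      simp
    · intro m hm hm0
      rw [← sum_smul, bergerPearcy_sum_pow_primitiveRoot_eq_zero hω hm0 (mem_range.mp hm),
        zero_smul]
  -- (C) positivity of each summand: `0 ≤ Re ⟪y_j, e⟫`
  have hC : ∀ j, 0 ≤ (⟪y j, e⟫_ℂ).re := fun j => by
    rw [← hA j, inner_sub_right, inner_smul_right, sub_re, bergerPearcy_re_inner_self,
      sub_nonneg]
    calc (μ j * ⟪y j, T (y j)⟫_ℂ).re ≤ ‖μ j * ⟪y j, T (y j)⟫_ℂ‖ := re_le_norm _
      _ = ‖⟪y j, T (y j)⟫_ℂ‖ := by rw [norm_mul, hμ1, one_mul]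
      _ ≤ ‖y j‖ ^ 2 := hT (y j)
  -- combine: `n ⟪x, e⟫ = Σ_j ⟪y_j, e⟫`
  have hsum : ((n : ℝ) : ℂ) * ⟪x, e⟫_ℂ = ∑ j ∈ range n, ⟪y j, e⟫_ℂ := by
    rw [← sum_inner, hB, inner_smul_left, conj_natCast, ofReal_natCast]
  have hre : 0 ≤ (n : ℝ) * (⟪x, e⟫_ℂ).re := by
    rw [← re_ofReal_mul, hsum, re_sum]
    exact sum_nonneg fun j _ => hC j
  have hre' : 0 ≤ (⟪x, e⟫_ℂ).re :=
    le_of_mul_le_mul_left (by simpa only [mul_zero] using hre) (Nat.cast_pos.mpr hn)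
  rw [he, inner_sub_right, inner_smul_right, sub_re, bergerPearcy_re_inner_self,
    sub_nonneg] at hre'
  exact hre'

/-- The power inequality for `w(T) ≤ 1` (Halmos's Problem 221: if `w(A) ≤ 1` then `w(Aⁿ) ≤ 1`;
Berger 1965 / Pearcy 1966): if `|⟪y, T y⟫| ≤ ‖y‖²` for all `y`, then `|⟪x, Tⁿ x⟫| ≤ ‖x‖²` for
all `n` and `x`.  From Pearcy's lemma `bergerPearcy_re_pow_mul_inner_pow_le` by rotating
`⟪x, Tⁿ x⟫` onto the positive real axis with a unit `zⁿ` (`Complex.exists_norm_eq_mul_self`; `ℂ` is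
algebraically closed, so unit complex numbers have unit `n`-th roots).
[cite: HalmosHSPB1982, Problem 221] -/
theorem bergerPearcy_norm_inner_pow_le_of_le_one (T : E →ₗ[ℂ] E)
    (hT : ∀ x : E, ‖⟪x, T x⟫_ℂ‖ ≤ ‖x‖ ^ 2) (n : ℕ) (x : E) :
    ‖⟪x, (T ^ n) x⟫_ℂ‖ ≤ ‖x‖ ^ 2 := by
  rcases Nat.eq_zero_or_pos n with rfl | hn
  · rw [pow_zero, Module.End.one_apply, bergerPearcy_norm_inner_self]
  set w : ℂ := ⟪x, (T ^ n) x⟫_ℂ with hw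
  -- rotate `w` onto the positive real axis: `‖w‖ = l w`, `‖l‖ = 1`, and take `zⁿ = l`
  obtain ⟨l, hl1, hlw⟩ := Complex.exists_norm_eq_mul_self w
  obtain ⟨z, hz⟩ := IsAlgClosed.exists_pow_nat_eq l hn
  have hz1 : ‖z‖ = 1 := by
    have h : ‖z‖ ^ n = 1 := by rw [← norm_pow, hz, hl1]
    exact (pow_eq_one_iff_of_nonneg (norm_nonneg z) hn.ne').mp h
  have key := bergerPearcy_re_pow_mul_inner_pow_le T hT hn hz1 x
  rwa [← hw, hz, ← hlw, ofReal_re] at key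

/-- **Berger–Pearcy power inequality for the numerical radius, `w(Tⁿ) ≤ w(T)ⁿ`** (def-free
form; C. A. Berger 1965, C. Pearcy 1966, Halmos Problem 221 with the scaling reduction given
there): a numerical-radius bound `c` for `T`, i.e. `|⟪x, T x⟫| ≤ c ‖x‖²` for all `x`, is a
numerical-radius bound `cⁿ` for `Tⁿ`: `|⟪x, Tⁿ x⟫| ≤ cⁿ ‖x‖²`, on any complex inner product space
(no completeness or finite-dimensionality needed).  Reduction to `c = 1`
(`bergerPearcy_norm_inner_pow_le_of_le_one`) by scaling `T ↦ c⁻¹ T` when `c > 0`; when `c = 0` the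
hypothesis forces `T = 0` by polarization (`inner_map_self_eq_zero`).
[cite: Pearcy1966, Theorem] -/
theorem numericalRadius_pow_le (T : E →ₗ[ℂ] E) {c : ℝ} (hc : 0 ≤ c)
    (hT : ∀ x : E, ‖⟪x, T x⟫_ℂ‖ ≤ c * ‖x‖ ^ 2) (n : ℕ) (x : E) :
    ‖⟪x, (T ^ n) x⟫_ℂ‖ ≤ c ^ n * ‖x‖ ^ 2 := by
  rcases Nat.eq_zero_or_pos n with rfl | hn
  · rw [pow_zero, Module.End.one_apply, bergerPearcy_norm_inner_self, pow_zero, one_mul]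
  rcases hc.lt_or_eq with hc | rfl
  · -- `c > 0`: scale to `S = c⁻¹ T` with `w(S) ≤ 1`
    have hcn : ‖((c : ℂ)⁻¹)‖ = c⁻¹ := by rw [norm_inv, Complex.norm_of_nonneg hc.le]
    set S : E →ₗ[ℂ] E := ((c : ℂ)⁻¹) • T with hS
    have hS' : ∀ x : E, ‖⟪x, S x⟫_ℂ‖ ≤ ‖x‖ ^ 2 := fun x => by
      rw [hS, LinearMap.smul_apply, inner_smul_right, norm_mul, hcn, inv_mul_le_iff₀ hc]
      exact hT x
    have h := bergerPearcy_norm_inner_pow_le_of_le_one S hS' n x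
    rwa [hS, smul_pow, LinearMap.smul_apply, inner_smul_right, norm_mul, norm_pow, hcn, inv_pow,
      inv_mul_le_iff₀ (pow_pos hc n)] at h
  · -- `c = 0`: then `T = 0`
    have hT0 : T = 0 := (inner_map_self_eq_zero T).mp fun x => by
      have h := hT x
      rw [zero_mul, norm_le_zero_iff] at h
      rw [← inner_conj_symm, h, map_zero]
    rw [hT0, zero_pow hn.ne', LinearMap.zero_apply, inner_zero_right, norm_zero, zero_pow hn.ne',
      zero_mul]

end PowerInequality

section NormBound

variable {E : Type*} [NormedAddCommGroup E] [InnerProductSpace ℂ E]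

/-- Polarization bound: if `|⟪u, T u⟫| ≤ c ‖u‖²` for all `u`, then `|⟪T x, y⟫| ≤ c (‖x‖² + ‖y‖²)`
for all `x, y` — the four terms of the complex polarization identity `inner_map_polarization'`
are bounded by `c ‖x ± y‖²`, `c ‖x ± i y‖²`, and the parallelogram law sums them to
`4 c (‖x‖² + ‖y‖²)`. [folklore] -/
theorem bergerPearcy_norm_inner_map_le (T : E →ₗ[ℂ] E) {c : ℝ}
    (hT : ∀ x : E, ‖⟪x, T x⟫_ℂ‖ ≤ c * ‖x‖ ^ 2) (x y : E) :
    ‖⟪T x, y⟫_ℂ‖ ≤ c * (‖x‖ ^ 2 + ‖y‖ ^ 2) := by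
  have hT' : ∀ u : E, ‖⟪T u, u⟫_ℂ‖ ≤ c * ‖u‖ ^ 2 := fun u => by
    rw [← inner_conj_symm, Complex.norm_conj]
    exact hT u
  have hIy : ‖I • y‖ = ‖y‖ := by rw [norm_smul, norm_I, one_mul]
  have hpar1 := parallelogram_law_with_norm ℂ x y
  have hpar2 := parallelogram_law_with_norm ℂ x (I • y)
  rw [hIy] at hpar2
  set A := ⟪T (x + y), x + y⟫_ℂ
  set B := ⟪T (x - y), x - y⟫_ℂ
  set C := ⟪T (x + I • y), x + I • y⟫_ℂ
  set D := ⟪T (x - I • y), x - I • y⟫_ℂ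
  have hnum : ‖A - B - I * C + I * D‖ ≤ ‖A‖ + ‖B‖ + ‖C‖ + ‖D‖ := by
    have eC : ‖I * C‖ = ‖C‖ := by rw [norm_mul, norm_I, one_mul]
    have eD : ‖I * D‖ = ‖D‖ := by rw [norm_mul, norm_I, one_mul]
    calc ‖A - B - I * C + I * D‖ ≤ ‖A - B - I * C‖ + ‖I * D‖ := norm_add_le _ _
      _ ≤ ‖A - B‖ + ‖I * C‖ + ‖I * D‖ := by gcongr; exact norm_sub_le _ _
      _ ≤ ‖A‖ + ‖B‖ + ‖I * C‖ + ‖I * D‖ := by gcongr; exact norm_sub_le _ _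
      _ = ‖A‖ + ‖B‖ + ‖C‖ + ‖D‖ := by rw [eC, eD]
  rw [inner_map_polarization' T x y, norm_div, RCLike.norm_ofNat]
  calc ‖A - B - I * C + I * D‖ / 4 ≤ (‖A‖ + ‖B‖ + ‖C‖ + ‖D‖) / 4 := by gcongr
    _ ≤ (c * ‖x + y‖ ^ 2 + c * ‖x - y‖ ^ 2 + c * ‖x + I • y‖ ^ 2 + c * ‖x - I • y‖ ^ 2) / 4 := by
      gcongr
      exacts [hT' _, hT' _, hT' _, hT' _]
    _ = c * (‖x‖ ^ 2 + ‖y‖ ^ 2) := by linear_combination (c / 4) * hpar1 + (c / 4) * hpar2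

/-- **The operator norm is at most twice the numerical radius, `‖T‖ ≤ 2 w(T)`** (def-free form;
Halmos, *A Hilbert space problem book*, §218: `½‖A‖ ≤ w(A) ≤ ‖A‖`): if `|⟪u, T u⟫| ≤ c ‖u‖²` for
all `u`, then `‖T x‖ ≤ 2 c ‖x‖`.  From the polarization bound `bergerPearcy_norm_inner_map_le`
with `y = (‖x‖/‖T x‖) T x`, so that `‖y‖ = ‖x‖` and `⟪T x, y⟫ = ‖x‖ ‖T x‖`.
[cite: HalmosHSPB1982, §218] -/
theorem norm_apply_le_two_mul_of_numericalRadius_le (T : E →ₗ[ℂ] E) {c : ℝ} (hc : 0 ≤ c)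
    (hT : ∀ x : E, ‖⟪x, T x⟫_ℂ‖ ≤ c * ‖x‖ ^ 2) (x : E) : ‖T x‖ ≤ 2 * c * ‖x‖ := by
  by_cases hTx : T x = 0
  · rw [hTx, norm_zero]
    positivity
  have hx : x ≠ 0 := fun h => hTx (by rw [h, map_zero])
  have hxpos : 0 < ‖x‖ := norm_pos_iff.mpr hx
  have hTxpos : 0 < ‖T x‖ := norm_pos_iff.mpr hTx
  set y : E := ((‖x‖ / ‖T x‖ : ℝ) : ℂ) • T x with hy
  have hny : ‖y‖ = ‖x‖ := by
    rw [hy, norm_smul, Complex.norm_of_nonneg (by positivity), div_mul_cancel₀ _ hTxpos.ne']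
  have hin : ‖⟪T x, y⟫_ℂ‖ = ‖x‖ * ‖T x‖ := by
    rw [hy, inner_smul_right, norm_mul, Complex.norm_of_nonneg (by positivity),
      bergerPearcy_norm_inner_self, div_mul_eq_mul_div, sq, ← mul_assoc,
      mul_div_cancel_right₀ _ hTxpos.ne']
  have h := bergerPearcy_norm_inner_map_le T hT x y
  rw [hin, hny] at h
  exact le_of_mul_le_mul_left (h.trans_eq (by ring)) hxpos

end NormBound

section MatrixForm

/-- **Matrix form of the power inequality: `‖Xⁿ v‖ ≤ 2 w(X)ⁿ ‖v‖`** (the power inequality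
`numericalRadius_pow_le` for `Xⁿ` combined with `‖·‖ ≤ 2 w(·)`,
`norm_apply_le_two_mul_of_numericalRadius_le`).  For a complex square matrix `X` acting on
`EuclideanSpace ℂ m` through `Matrix.toEuclideanLin` (definitionally `v ↦ X *ᵥ v` in the `L²`
norm) with `|⟪v, X v⟫| ≤ c ‖v‖²` for all `v`, every power satisfies `‖Xⁿ v‖ ≤ 2 cⁿ ‖v‖`.
[folklore] -/
theorem matrix_norm_pow_mulVec_le_two_mul_numericalRadius_pow {m : Type*} [Fintype m]
    [DecidableEq m] (X : Matrix m m ℂ) {c : ℝ} (hc : 0 ≤ c)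
    (hX : ∀ v : EuclideanSpace ℂ m, ‖⟪v, Matrix.toEuclideanLin X v⟫_ℂ‖ ≤ c * ‖v‖ ^ 2) (n : ℕ)
    (v : EuclideanSpace ℂ m) : ‖Matrix.toEuclideanLin (X ^ n) v‖ ≤ 2 * c ^ n * ‖v‖ := by
  have hpow : (Matrix.toEuclideanLin (X ^ n) : EuclideanSpace ℂ m →ₗ[ℂ] EuclideanSpace ℂ m) =
      (Matrix.toEuclideanLin X : EuclideanSpace ℂ m →ₗ[ℂ] EuclideanSpace ℂ m) ^ n := by
    rw [← Matrix.coe_toEuclideanCLM_eq_toEuclideanLin, map_pow, ContinuousLinearMap.coe_pow,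
      Matrix.coe_toEuclideanCLM_eq_toEuclideanLin]
  rw [hpow]
  exact norm_apply_le_two_mul_of_numericalRadius_le _ (pow_nonneg hc n)
    (numericalRadius_pow_le _ hc hX n) v

end MatrixForm

end Literature.Analysis.InnerProduct
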